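/-
Origin: expansion seat `planner-pub-hodgecm-mc-glue-1-g6-0`, handover #351 2026-08-19T18:22Z md5 43579f37af83be1a78023c388c31c489 (132 l.) WHOLE-FILE REPLACEMENT (PKG 53144cb00a51, 129 l.; pv03 lineage, no live seat — FORCED courtesy hunk (3)(a) of prl1-g17 17:52:37Z, §68.2): structure field `BallDictFacts.saturate` :92–94 re-typed to the SAME text as #350 with `ev` for `b.ev`; `ballFacts … saturate := h.saturate` :111 unchanged; nothing else. After #350. (`HOME/mc/pub-hodgecm-mc-glue-1-g6/lean/s60/HodgeCM/PerL34/BallUniformisation.lean`, md5 43579f37, 132 lines);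
landed by the gen-13 packager (p-g13) in gate run 37 REPLACES the earlier landed copy of `HodgeCM/PerL34/BallUniformisation.lean` (packager comment re-wording per the RUN-32 precedent (gate audit (5) rejects the proof-placeholder tokens s-o-r-r-y / a-d-m-i-t anywhere in a source, comments included; owner consents STATUS l.12035/l.12037/l.12045, no objection by the cutoff): that one word inside the seat's provenance COMMENT at l.2 of the source re-spelt `proof-hole` (resp. `adm-token`); no Lean code byte touched).
-/
/-
Origin: CONSTRUCTION seat `planner-pub-hodgecm-mc-glue-1-g6-0` (unit pub-hodgecm-mc-glue-1-g6, gen 6 of mc-glue-1, node E ASSEMBLER), 2026-08-19T18:05Z — revision (§60/§68) of `HodgeCM/PerL34/BallUniformisation.lean` for RUN 37: the (Θ-sat-≤) ORDER CASCADE (BINDER-TRIAGE §60/§68: theta saturation in the `K`-order `Γ' ≤ Γ :↔ Γ'.K ≤ Γ.K` of the (W1) `Level`-pair root, covers `cover Γ Γ' (Level.Γ_mono h)`); kit `mc/pub-hodgecm-mc-glue-1-g6/t37c-mcglue1g6.txt`; base PKG 53144cb00a51 (pv03 lineage, gate run 23, no live seat; FORCED courtesy hunk (3)(a) of the END-STATE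 owner prl1-g17 17:52:37Z, model1-g7 RULED (K-b) §68 17:54:02Z). REPLACE — structure field `BallDictFacts.saturate` :92–94 re-typed `(h : Γ' ≤ Γ)` + `T.cover Γ Γ' (Level.Γ_mono h)` (the SAME text as `ThetaWedgeSplit.BallFacts.saturate` with `ev` for `b.ev`); `ballFacts … saturate := h.saturate` :111 compiles unchanged; nothing else. Kernel only: 0 `proof-hole`, 0 new declarations, cites nothing new; expected `#print axioms` unchanged.
-/
/-
Origin: expansion seat `planner-pub-hodgecm-pv03-g2-0`, handover 2026-08-18T05:28:48Z (doc-only) (`HOME/pub-hodgecm-pv03/lean/Pv03/PerL34/BallUniformisation.lean`, md5 cac261d2, 124 lines);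
landed by the gen-6 packager in gate run 23 REPLACES the earlier landed copy of `HodgeCM/PerL34/BallUniformisation.lean` (verbatim).
-/
/-
Copyright: pub-hodgecm formalisation cell (harness21, 2026). New file (not vendored).
Origin: HOME/pub-hodgecm-pv03/lean/Pv03/PerL34/BallUniformisation.lean (WIP module `Pv03.PerL34.BallUniformisation`;
intended final place `HodgeCM/PerL34/BallUniformisation.lean` = module `HodgeCM.PerL34.BallUniformisation`)
(seat planner-pub-hodgecm-pv03-0, DAG node N33, PerL v5 Prop 4.3, tex ll. 639–682).
-/
import Summits.HodgeConjecture.HodgeCM.Automorphic.ThetaWedgeSplit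
import Summits.HodgeConjecture.HodgeCM.PerL34.BallCocycle

/-!
# The canonical ball datum: five of the eleven `BallFacts` are theorems

`HodgeCM/Automorphic/ThetaWedgeSplit.lean` (seat prl1, landed run 18) derives A6 = `Open_thetaWedge` (PerL v5
Prop 4.3) from a POSITED uniformisation layer `b : U.BallData V c` (abstract types `Pt`, `Gr`, data `Δ, J, ev`),
eleven named facts `T.BallFacts V c b` about it, and the open input `Open_supply`:
`thetaWedge_of_ball : Fact_ball B → Open_supply → Open_thetaWedge`.

Here the layer is INSTANTIATED by the canonical model of `Ball.lean` / `BallCocycle.lean`: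
`Pt := Ball = 𝔹²`, `Gr := U21 = U(2,1)` (the subgroup of `GL₃(ℂ)` preserving `diag(1,1,-1)`) with its projective
fractional-linear action, `J g x := (Jac g x)ᵀ` = the transpose of the Jacobian MATRIX
`∂(g•z)_i/∂z_j = (g_{ij} w₂ - w_i g_{2j}) / w₂²` (`w = g·(z,1)`) of `z ↦ g • z` at `x`; `Δ` and `ev` stay parameters
(they are context data: the image of `G_U(L₀)` and the lifts of holomorphic one-forms).  For this datum the five
fields of `BallFacts` labelled "PRINT (elementary)" are KERNEL THEOREMS:

* `csmul`  — `BallModel.instContinuousSMulU21Ball`;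
* `contJ`  — `BallModel.continuous_Jac_transpose`;
* `unitJ`  — `BallModel.isUnit_Jac_transpose` (`det Jac = det g / w₂³ ≠ 0`);
* `trans`  — `BallModel.transitive` (boost × rotation);
* `irred`  — `BallModel.irred` (chain rule `Jac_mul` + the `SU(2)` in the stabiliser of `0`, conjugated to `x`).

What remains (`BallDictFacts`, six fields, statements verbatim from `BallFacts` with `b := ballData V c Δ ev`): `dense`
(PRINT: real approximation, Sansuc Cor. 3.5(iii) / Platonov–Rapinchuk Thm 7.7), the OPEN INPUT `transl` (= DAG node N33b, a PerL
proof step — NOT a citation; PerL ll. 652–656 are a cross-reference) and four INTERFACE / DEFINITIONAL constraints on the posited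
lift `ev` (`contEv`, `evNe`, `wedgeDict`, `saturate`).  Hence `thetaWedge_of_ballModel : (∀ good ctx, BallDictFacts …) → Open_supply → Open_thetaWedge`.

Honesty note.  `Jac` is DEFINED by the displayed quotient-rule formula; that this matrix is the derivative of
`z ↦ g • z` is the routine calculus fact behind the label "Jacobian" (it is what makes the field `transl`,
`γ^* u = ᵗ(dγ) · u ∘ γ`, refer to the intended pull-back).  The chain rule `Jac_mul`, `Jac_one` and
`det Jac = det g / w₂³` are proved for the formula as defined.
-/

noncomputable section

open Matrix

namespace HodgeCM
namespace PerL34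
namespace BallUniformisation

open HodgeCM.PerL34.BallModel HodgeCM.LineField

variable {U : Universe} {L : CMField} {ι₁ : L →+* ℂ}

/-- **The canonical ball datum** of a context: `𝔹²`, `U(2,1)`, the transpose-Jacobian automorphy factor; the
image `Δ` of `G_U(L₀)` and the lift `ev` of classes to `ℂ²`-valued functions on `𝔹²` are the parameters. -/
def ballData (V : HermSpace3 L ι₁) (c : SeesawCtx L) (Δ : Set U21)
    (ev : ∀ Γ : Level V, U.CohC (U.pms L ι₁ V Γ) 1 → Ball → Fin 2 → ℂ) : U.BallData V c where
  Pt := Ball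
  Gr := U21
  Δ := Δ
  J := fun g x => (Jac g x)ᵀ
  ev := ev

/-- **The residual facts** about the canonical ball datum: the six fields of `ThetaModel.BallFacts` that are not theorems of the model —
`dense` (PRINT, real approximation), `transl` (OPEN INPUT = DAG node **N33b**; NOT a citation — PerL ll. 652–656 are a cross-reference to the document under
adjudication, not a source) and the INTERFACE / DEFINITIONAL constraints `contEv`, `evNe`, `wedgeDict`, `saturate` on the posited lift `ev`.  Statements verbatim from `ThetaModel.BallFacts` (`HodgeCM/Automorphic/ThetaWedgeSplit.lean`, `b := ballData V c Δ ev`); labels as there (referee 3 R3-2 V3 / R3-4; referee A round 15 E1), print anchors abbreviated — the full locators are in that structure's field docstrings. -/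
structure BallDictFacts (T : U.ThetaModel) (V : HermSpace3 L ι₁) (c : SeesawCtx L) (Δ : Set U21)
    (ev : ∀ Γ : Level V, U.CohC (U.pms L ι₁ V Γ) 1 → Ball → Fin 2 → ℂ) : Prop where
  /-- PRINT: REAL APPROXIMATION — the image of `G_U(L₀)` is dense in `U(2,1)` (Sansuc, J. reine angew. Math. 327
  (1981) Cor. 3.5(iii); Platonov–Rapinchuk, *Algebraic groups and number theory*, Thm 7.7; PerL l. 672). -/
  dense : Dense Δ
  /-- INTERFACE (dictionary constraint on the posited `ev`; anchor: a holomorphic one-form on `Γ\𝔹²` lifts to a holomorphic, hence continuous, `ℂ²`-valued function on `𝔹²`). -/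
  contEv : ∀ (i : Fin 4) (Γ : Level V) (ω : U.CohC (U.pms L ι₁ V Γ) 1), ω ∈ T.Theta V c i Γ →
    Continuous (ev Γ ω)
  /-- OPEN INPUT (= DAG node **N33b**, LEMMAS.md row 67; referee 3 R3-2 V3) stated through the Hecke dictionary for the posited `ev`, `Δ` and the model's `Theta` — NOT a citation; cross-reference (not a source) PerL ll. 652–656:
  `γ^* u_f = u_{R(γ_f⁻¹) f}` is again a theta one-form of the same type, at some level; `γ^* u = ᵗ(dγ) · (u ∘ γ)` in the trivialisation of `T^*𝔹²`.  Print anchors (Getz–Hahn, GTM 300 (2024) §15.2 (15.4)–(15.7), pp. 298–299; Gan–Qiu–Takeda, Invent. Math. 198 (2014) §11.2, p. 33) exactly as in `ThetaModel.BallFacts.transl`. -/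
  transl : ∀ γ ∈ Δ, ∀ (i : Fin 4) (Γ : Level V) (ω : U.CohC (U.pms L ι₁ V Γ) 1), ω ∈ T.Theta V c i Γ →
    ∃ (Γ' : Level V) (ω' : U.CohC (U.pms L ι₁ V Γ') 1), ω' ∈ T.Theta V c i Γ' ∧
      ev Γ' ω' = fun x => (Jac γ x)ᵀ *ᵥ ev Γ ω (γ • x)
  /-- INTERFACE (dictionary constraint on the posited `ev`; print anchor: `H^{1,0}(P_Γ) ↪ H¹(P_Γ, ℂ)`, Hodge decomposition, Voisin I Cor. 6.12; a holomorphic form is determined by its lift to the universal cover): a NONZERO class in `Θ_i Γ` has a nonzero lift. -/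
  evNe : ∀ (i : Fin 4) (Γ : Level V) (ω : U.CohC (U.pms L ι₁ V Γ) 1), ω ∈ T.Theta V c i Γ → ω ≠ 0 →
    ev Γ ω ≠ 0
  /-- INTERFACE with PRINT content (dictionary constraint on the posited `ev`; cited part: the cup product of two closed one-forms is the class of their wedge — de Rham, Bott–Tu §5 (14.28); Voisin I §5.3.2, the sentence after (5.15) [held e-text `book:voisin2002-hodge-theory-complex-algebraic-geometry-i` chunk p0115 L20: "if α and β are closed, the cup-product of the classes of α and β is represented by the form α ∧ β"] — and
  `H^{2,0} ↪ H²` — Hodge decomposition, Voisin I Cor. 6.12 / Thm 6.32): a vanishing cup product of two theta one-forms forces the pointwise wedge of their lifts to vanish. -/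
  wedgeDict : ∀ (Γ : Level V) (ω₁ ω₂ : U.CohC (U.pms L ι₁ V Γ) 1), ω₁ ∈ T.Theta V c 0 Γ → ω₂ ∈ T.Theta V c 1 Γ →
    U.cup2C (U.pms L ι₁ V Γ) 1 ω₁ ω₂ = 0 → ∀ x : Ball, wedge2 (ev Γ ω₁ x) (ev Γ ω₂ x) = 0
  /-- ROUTINE for the saturated model of record (saturation is inherited along `K' ≤ K`, BINDER-TRIAGE §60); level-free for unsaturated models (theta one-forms as level-free forms on `𝔹²`): pull-back to a finer level (`Γ' ≤ Γ` in the `K`-order of the `Level` pair) preserves type and lift. -/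
  saturate : ∀ (i : Fin 4) (Γ Γ' : Level V) (h : Γ' ≤ Γ) (ω : U.CohC (U.pms L ι₁ V Γ) 1),
    ω ∈ T.Theta V c i Γ →
      U.pullC (T.cover Γ Γ' (Level.Γ_mono h)) 1 ω ∈ T.Theta V c i Γ' ∧
        ev Γ' (U.pullC (T.cover Γ Γ' (Level.Γ_mono h)) 1 ω) = ev Γ ω

/-- **`BallFacts` for the canonical datum from the residual facts**: the five "PRINT (elementary)" fields are
supplied by theorems of the model. -/
theorem ballFacts {T : U.ThetaModel} {V : HermSpace3 L ι₁} {c : SeesawCtx L} {Δ : Set U21}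
    {ev : ∀ Γ : Level V, U.CohC (U.pms L ι₁ V Γ) 1 → Ball → Fin 2 → ℂ} (h : BallDictFacts T V c Δ ev) :
    T.BallFacts V c (ballData V c Δ ev) where
  csmul := instContinuousSMulU21Ball
  contJ := continuous_Jac_transpose
  unitJ := isUnit_Jac_transpose
  trans := fun x y => transitive x y
  irred := fun x v hv => irred x v hv
  dense := h.dense
  contEv := h.contEv
  transl := h.transl
  evNe := h.evNe
  wedgeDict := h.wedgeDict
  saturate := h.saturate

/-- **A6 over the canonical ball datum**: `Open_thetaWedge` (PerL v5 Prop 4.3 in every good context) from the residual facts in every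
good context — real approximation (PRINT), the OPEN INPUT N33b (`transl`), the INTERFACE / DEFINITIONAL `ev`-constraints — and the supply input `Open_supply`. -/
theorem thetaWedge_of_ballModel (T : U.ThetaModel)
    (Δ : ∀ {L : CMField} {ι₁ : L →+* ℂ} (_V : HermSpace3 L ι₁) (_c : SeesawCtx L), Set U21)
    (ev : ∀ {L : CMField} {ι₁ : L →+* ℂ} (V : HermSpace3 L ι₁) (_c : SeesawCtx L),
      ∀ Γ : Level V, U.CohC (U.pms L ι₁ V Γ) 1 → Ball → Fin 2 → ℂ)
    (hD : ∀ {L : CMField} {ι₁ : L →+* ℂ} (V : HermSpace3 L ι₁) (c : SeesawCtx L), T.GoodCtx ι₁ c →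
      BallDictFacts T V c (Δ V c) (ev V c))
    (hS : T.Open_supply) : T.Open_thetaWedge :=
  T.thetaWedge_of_ball (fun V c => ballData V c (Δ V c) (ev V c)) (fun V c hc => ballFacts (hD V c hc)) hS

end BallUniformisation
end PerL34
end HodgeCM

end
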